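import Summits.CriticalPhenomena.CardyFormulaZ2.Theorems.CardyMagicRigidityMarkovCascadeDefs
import Literature.Probability.Percolation.SiteLoopDensity

/-!
# `d_CN`-closeness from local density along small loops and matching of big loops: stub
`isClose_of_localDense_of_forall_big` of line `markov-cascade-one-generation` for crux
`NestingRigidity` (stmt-CriticalPhenomena-4835)

The *local-density* twin of the deterministic metric reduction `isClose_of_dense_of_forall_big`
(`CardyMagicRigidityNestingRigidityIsCloseReduction.lean`) of DKKMO's relation
`LoopConfig.IsClose ε c c'` (`d_CN(c, c') ≤ ε`). Density of the other configuration is required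
only *along the small loops* of each configuration, which is the form usable for domain ensembles
(they have no loops outside the domain): `IsClose ε c c'` holds as soon as

* (local density) every loop `u` of either configuration with trace in the window `B(0, 1/ε)` and
  of diameter `< ε/8` has a point `z` of its trace and a same-type loop of the other configuration
  with trace inside `B(z, ε/4)`, and
* (big loops) every loop of either configuration with trace in the window and of diameter `≥ ε/8`
  has a same-type partner in the other configuration at `udist ≤ ε`.

Indeed for a small loop `u` with `z ∈ u.range` and partner `u'` with trace in `B(z, ε/4)`, the
trace of `u` lies in `closedBall z (ε/8) ⊆ closedBall z (ε/4)` (`Metric.dist_le_diam_of_mem`, the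
trace being compact hence bounded), so both traces lie in `closedBall z (ε/4)` and
`udist u u' ≤ 2 · (ε/4) ≤ ε` (`UnbasedLoop.udist_le_of_subset_closedBall`).
-/

noncomputable section

open MeasureTheory Set Filter
open scoped Topology BigOperators ENNReal Real

namespace Summit.CriticalPhenomena.CardyFormulaZ2.Cruxes.NestingRigidity.MarkovCascadeOneGeneration

open Literature.Probability.RandomPlanarGeometry Literature.Probability.Percolation
  Literature.Probability.LatticeModels
open Summit.CriticalPhenomena.CardyFormulaZ2.Theses.CardyMagicRigidity

/-- The metric core of the matching of a small loop: if `u` has diameter `< ε/8`, `z ∈ u.range`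
and the trace of `u'` lies in `B(z, ε/4)`, then `udist u u' ≤ ε`. [folklore] -/
theorem udist_le_of_diam_lt_of_subset_ball {ε : ℝ} (hε : 0 < ε) {u u' : UnbasedLoop ℂ} {z : ℂ}
    (hd : Metric.diam u.range < ε / 8) (hz : z ∈ u.range)
    (hu' : u'.range ⊆ Metric.ball z (ε / 4)) : u.udist u' ≤ ε := by
  have h1 : u.range ⊆ Metric.closedBall z (ε / 4) := fun x hx ↦ by
    rw [Metric.mem_closedBall]
    calc dist x z ≤ Metric.diam u.range :=
          Metric.dist_le_diam_of_mem u.isCompact_range.isBounded hx hz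
      _ ≤ ε / 4 := by linarith
  have h2 : u'.range ⊆ Metric.closedBall z (ε / 4) := hu'.trans Metric.ball_subset_closedBall
  calc u.udist u' ≤ 2 * (ε / 4) :=
        UnbasedLoop.udist_le_of_subset_closedBall (by positivity) h1 h2
    _ ≤ ε := by linarith

/-- One half of the local `d_CN` reduction, for one type: if every loop of the family `A` in the
window `B(0, 1/ε)` of diameter `< ε/8` has a point `z` of its trace and a loop of the family `B`
with trace in `B(z, ε/4)`, and every loop of `A` in the window of diameter `≥ ε/8` has a partner in
`B` at `udist ≤ ε`, then every loop of `A` in the window has a partner in `B` at `udist ≤ ε`. [folklore] -/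
theorem forall_exists_udist_le_of_localDense_of_forall_big {ε : ℝ} (hε : 0 < ε)
    {A B : Set (UnbasedLoop ℂ)}
    (hdense : ∀ u ∈ A, u.range ⊆ Metric.ball (0 : ℂ) (1 / ε) → Metric.diam u.range < ε / 8 →
      ∃ z ∈ u.range, ∃ u' ∈ B, u'.range ⊆ Metric.ball z (ε / 4))
    (hbig : ∀ u ∈ A, u.range ⊆ Metric.ball (0 : ℂ) (1 / ε) → ε / 8 ≤ Metric.diam u.range →
      ∃ u' ∈ B, u.udist u' ≤ ε) :
    ∀ u ∈ A, u.range ⊆ Metric.ball (0 : ℂ) (1 / ε) → ∃ u' ∈ B, u.udist u' ≤ ε := by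
  intro u hu hw
  rcases lt_or_ge (Metric.diam u.range) (ε / 8) with hd | hd
  · obtain ⟨z, hz, u', hu', hu'r⟩ := hdense u hu hw hd
    exact ⟨u', hu', udist_le_of_diam_lt_of_subset_ball hε hd hz hu'r⟩
  · exact hbig u hu hw hd

/-- **`d_CN(c, c') ≤ ε` from `ε/4`-density of the other configuration along the small loops
(diameter `< ε/8`) of each configuration in the window and matching of the loops of diameter
`≥ ε/8`** (the local form of the deterministic reduction `isClose_of_dense_of_forall_big`, usable
for the domain ensembles of the Markov cascade, which carry no loops outside their domain). [folklore] -/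
theorem isClose_of_localDense_of_forall_big : ∀ {ε : ℝ} {c c' : LoopConfig ℂ}, 0 < ε → (∀ i : Fin 2, ∀ u ∈ c.F i, u.range ⊆ Metric.ball (0 : ℂ) (1 / ε) → Metric.diam u.range < ε / 8 → ∃ z ∈ u.range, ∃ u' ∈ c'.F i, u'.range ⊆ Metric.ball z (ε / 4)) → (∀ i : Fin 2, ∀ u' ∈ c'.F i, u'.range ⊆ Metric.ball (0 : ℂ) (1 / ε) → Metric.diam u'.range < ε / 8 → ∃ z ∈ u'.range, ∃ u ∈ c.F i, u.range ⊆ Metric.ball z (ε / 4)) → (∀ i : Fin 2, ∀ u ∈ c.F i, u.range ⊆ Metric.ball (0 : ℂ) (1 / ε) → ε / 8 ≤ Metric.diam u.range → ∃ u' ∈ c'.F i, u.udist u' ≤ ε) → (∀ i : Fin 2, ∀ u' ∈ c'.F i, u'.range ⊆ Metric.ball (0 : ℂ) (1 / ε) → ε / 8 ≤ Metric.diam u'.range → ∃ u ∈ c.F i, u'.udist u ≤ ε) → LoopConfig.IsClose ε c c' := by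
  intro ε c c' hε hdense hdense' hbig hbig' i
  exact ⟨forall_exists_udist_le_of_localDense_of_forall_big hε (hdense i) (hbig i),
    forall_exists_udist_le_of_localDense_of_forall_big hε (hdense' i) (hbig' i)⟩

end Summit.CriticalPhenomena.CardyFormulaZ2.Cruxes.NestingRigidity.MarkovCascadeOneGeneration

end
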